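import Summits.HodgeConjecture.HodgeConjecture.Cruxes.H413.Lines.F0_U3LettersRung1

/-!
# PROBE (F0P3-p04 (g9), K9β §A author lineage) — `SpecPkgT1` AT AN OVERRIDE IS CONTENT-FREE BY ITSELF

For EVERY comparison kit `𝔨` there is a `SpecOverride` (the «geometric costume»: `SθG := SJ_G`, `SθH := SJ_H`, all four `M`-terms `:= 0`,
ONE-POINT packet sets with `n := 1` and `tr := SJ_G` ∕ `SJ_H`) under which T1c ∧ T1d ∧ T1e ∧ T1f hold with NO hypothesis on `𝔨`.
Consequence for the desk's (γ⁺) ruling 23:43:36Z: a letter «∃ distributions + packet sets satisfying T1c ∧ T1e ∧ T1f (∧ T1d) as typed against T1's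
geometric sockets» is junk-witnessable — T1c reading the kit's `SJ` sockets does NOT pin it; the pin can only come from laws that see the packet MEMBERS'
local data (K9-3∕K9-4∕K9-5: `aPacketSpectral` ∕ `localExpansion` ∕ anchors over the same `PacketG`), so K9-0b♯ must stay bundled with them under one ∃.
-/

noncomputable section

open NumberField MeasureTheory
open Summit.HodgeConjecture.HodgeConjecture.Cruxes.H413.F0T1InnerFormTraceIdentity

namespace F0P3p04g9.Probe

variable {L : Type} [Field L] [NumberField L] [IsCMField L] {H : Matrix (Fin 3) (Fin 3) L}
  {μ : MeasureTheory.Measure (Literature.NumberTheory.Automorphic.UnitaryGroup.cmDatum L 3 H).automorphicQuotient}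
  [(Literature.NumberTheory.Automorphic.UnitaryGroup.cmDatum L 3 H).IsAutomorphicMeasure μ]

/-- The geometric costume of a kit: the six spectral distributions aliased to the kit's own `SJ`-totals (M-terms zero), one-point packet sets
carrying `SJ_G` ∕ `SJ_H` as their «trace». -/
def junkOverride (𝔨 : ComparisonKit L H μ) : SpecOverride L where
  SθG := 𝔨.SJGtot
  SθH := 𝔨.SJHtot
  SθM := 0
  SJM := 0
  SθMH := 0
  SJMH := 0
  PacketG := PUnit
  PacketH := PUnit
  nG := fun _ => 1
  nH := fun _ => 1
  trG := fun _ f => 𝔨.SJGtot f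
  trH := fun _ fH => 𝔨.SJHtot fH

/-- **KERNEL FACT: T1c ∧ T1d ∧ T1e ∧ T1f hold at the costume override of ANY kit, with no hypothesis.** -/
theorem specPkgT1_junkOverride (𝔨 : ComparisonKit L H μ) : (𝔨.override (junkOverride 𝔨)).SpecPkgT1 where
  t1c := by
    intro f' f fH _
    constructor
    · show 𝔨.SJGtot f = 𝔨.SJGtot f + 0 - 0
      simp
    · show 𝔨.SJHtot fH = 𝔨.SJHtot fH + 0 - 0
      simp
  t1d := by
    intro f' f fH _
    show ((0 : ℂ) + (1 / 2 : ℂ) * 0) - (0 + (1 / 2 : ℂ) * 0) = 0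
    simp
  t1e := by
    intro f' f _ _
    show Summable (fun _ : PUnit => (1 : ℂ) * 𝔨.SJGtot f) ∧ 𝔨.SJGtot f = ∑' _ : PUnit, (1 : ℂ) * 𝔨.SJGtot f
    refine ⟨(hasSum_fintype _).summable, ?_⟩
    simp
  t1f := by
    intro f' fH _ _
    show Summable (fun _ : PUnit => (1 : ℂ) * 𝔨.SJHtot fH) ∧ 𝔨.SJHtot fH = ∑' _ : PUnit, (1 : ℂ) * 𝔨.SJHtot fH
    refine ⟨(hasSum_fintype _).summable, ?_⟩
    simp

/-- Hence T1's HEAD for the costume kit follows from T1a, T1b, T1g at `𝔨` ALONE (★ `innerFormStableTraceIdentity_override`): the «spectral side» it then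
speaks of is `SJ_G(f) + ½ SJ_H(f^H)` in disguise — (14.6.1)'s content is absent. -/
theorem innerFormStableTraceIdentity_junk (𝔨 : ComparisonKit L H μ) (ha : 𝔨.SimpleTraceFormula) (hb : 𝔨.EllipticStabilisation)
    (hg : 𝔨.TransferExistence) : (𝔨.override (junkOverride 𝔨)).InnerFormStableTraceIdentity :=
  𝔨.innerFormStableTraceIdentity_override (junkOverride 𝔨) ha hb hg (specPkgT1_junkOverride 𝔨)

end F0P3p04g9.Probe

end
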